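import Mathlib
import HarnessLib

/-!
# The 2-adic chirp `φ(u) = s(a · ind u mod 2^{k-2})`: exact balance and small ×p-defect

Stub D of the cycle-6 movement of line Sketch/LAR of crux stmt-QuantumAdvantage-1392
(`DigitPolyUniformity`).  Write `M = 2^{k−2}`, `H = 2^{k−3} = M/2` (`k ≥ 3`), `a = 2b+1` (odd, hence a
unit modulo `M`), and let `s` be the square wave of period `M`: `s(x) = 1` if `x mod M < H` and
`s(x) = −1` otherwise.  The abstract 2-adic logarithm `ind` is only assumed additive on odd products
modulo `M` (`hhom`) and to carry each class `{u < 2^k : u ≡ w (mod 2^j)}` (`w` odd, `2 ≤ j ≤ k`)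
bijectively onto the progression `{t < M : t ≡ ind w (mod 2^{j−2})}`, stated as an equality of sums
(`hbij`).  For `φ(u) = s(a · ind u)` we prove:

* (i) `φ` sums to `0` over every class `u ≡ w (mod 2^j)`, `w` odd, `1 ≤ j ≤ k − 1`: adding `H` to `t`
  preserves the progression `t ≡ c (mod 2^{j−2})` (as `2^{j−2} ∣ H`) and flips the sign of `s(a t)`
  (as `aH ≡ H (mod M)`), so the two halves `[0,H)` and `[H,M)` of the progression cancel; the class of
  odd numbers (`j = 1`) is the disjoint union of the classes of `1` and `3` modulo `4`.
* (ii) if `a · ind(p)/M` is within `δ` of `1/2` modulo `1` then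
  `#{u < 2^k odd : φ(pu) = φ(u)} ≤ 2δ·2^{k−1} + 2`: by `hhom`, `φ(pu) = s(x_u + θ)` with
  `x_u = a · ind u` and `θ = a · ind p mod M`; over the odd `u < 2^k` the residue `x_u mod M` takes
  every value exactly twice (`hbij` with `j = 2` and the permutation `t ↦ a t` of `ℤ/M`), and a shift
  of the square wave by `θ` agrees with it on at most `|M − 2θ|` points of a period; finally
  `|M − 2θ| ≤ 2δM` unless `δ ≥ 1/2`, in which case the trivial bound `2M = 2^{k−1}` suffices.

All statements are elementary. [folklore]
-/

noncomputable section

namespace Summit.QuantumAdvantage.DigitPolyUniformity.SketchLAR.Chirp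

open Finset

/-- `(if c then 1 else -1) = (if d then 1 else -1)` in `ℝ` iff `c ↔ d`. [folklore] -/
private lemma ite_pm_one_eq_iff (c d : Prop) [Decidable c] [Decidable d] :
    ((if c then (1 : ℝ) else -1) = if d then (1 : ℝ) else -1) ↔ (c ↔ d) := by
  by_cases hc : c <;> by_cases hd : d <;> simp [hc, hd] <;> norm_num

/-- A shift of the square wave of period `M = 2H` (equal to `1` on `[0,H)` and `−1` on `[H,M)`) by `θ < M`
agrees with the square wave on at most `|M − 2θ|` points of a period. [folklore] -/
private lemma card_shift_agree_le (M H θ : ℕ) (hMH : M = H + H) (hθ : θ < M) :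
    ((((range M).filter (fun x => ((x + θ) % M < H ↔ x < H))).card : ℕ) : ℝ) ≤ |(M : ℝ) - 2 * θ| := by
  rcases le_or_gt θ H with hθH | hθH
  · have hsub : (range M).filter (fun x => ((x + θ) % M < H ↔ x < H)) ⊆ range (H - θ) ∪ Ico H (M - θ) := by
      intro x hx
      simp only [mem_filter, mem_range] at hx
      simp only [mem_union, mem_range, mem_Ico]
      obtain ⟨hxM, hA⟩ := hx
      rcases Nat.lt_or_ge (x + θ) M with h | h
      · rw [Nat.mod_eq_of_lt h] at hA; omega
      · rw [Nat.mod_eq_sub_mod h, Nat.mod_eq_of_lt (by omega)] at hA; omega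
    have hcard := (card_le_card hsub).trans (card_union_le _ _)
    rw [card_range, Nat.card_Ico] at hcard
    have hnat : ((range M).filter (fun x => ((x + θ) % M < H ↔ x < H))).card ≤ M - 2 * θ := by omega
    have hcast : ((M - 2 * θ : ℕ) : ℝ) = (M : ℝ) - 2 * θ := by
      rw [Nat.cast_sub (by omega)]; push_cast; ring
    calc _ ≤ ((M - 2 * θ : ℕ) : ℝ) := by exact_mod_cast hnat
      _ = (M : ℝ) - 2 * θ := hcast
      _ ≤ _ := le_abs_self _
  · have hsub : (range M).filter (fun x => ((x + θ) % M < H ↔ x < H)) ⊆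
        Ico (M - θ) H ∪ Ico (M + H - θ) M := by
      intro x hx
      simp only [mem_filter, mem_range] at hx
      simp only [mem_union, mem_Ico]
      obtain ⟨hxM, hA⟩ := hx
      rcases Nat.lt_or_ge (x + θ) M with h | h
      · rw [Nat.mod_eq_of_lt h] at hA; omega
      · rw [Nat.mod_eq_sub_mod h, Nat.mod_eq_of_lt (by omega)] at hA; omega
    have hcard := (card_le_card hsub).trans (card_union_le _ _)
    rw [Nat.card_Ico, Nat.card_Ico] at hcard
    have hnat : ((range M).filter (fun x => ((x + θ) % M < H ↔ x < H))).card ≤ 2 * θ - M := by omega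
    have hcast : ((2 * θ - M : ℕ) : ℝ) = 2 * θ - (M : ℝ) := by
      rw [Nat.cast_sub (by omega)]; push_cast; ring
    calc _ ≤ ((2 * θ - M : ℕ) : ℝ) := by exact_mod_cast hnat
      _ = 2 * θ - (M : ℝ) := hcast
      _ ≤ _ := by rw [abs_sub_comm]; exact le_abs_self _

/-- Multiplication by a number `a` coprime to `M` permutes `range M` (through `t ↦ a t mod M`), so it does not
change a sum over a full period. [folklore] -/
private lemma sum_range_mul_mod (M a : ℕ) (hM : 0 < M) (hcop : Nat.Coprime a M) (F : ℕ → ℝ) :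
    ∑ t ∈ range M, F (a * t % M) = ∑ x ∈ range M, F x := by
  have hinj : Set.InjOn (fun t => a * t % M) (range M : Set ℕ) := by
    intro t₁ ht₁ t₂ ht₂ h
    simp only [coe_range, Set.mem_Iio] at ht₁ ht₂
    have h' : t₁ ≡ t₂ [MOD M] := Nat.ModEq.cancel_left_of_coprime hcop.symm h
    rw [Nat.ModEq, Nat.mod_eq_of_lt ht₁, Nat.mod_eq_of_lt ht₂] at h'
    exact h'
  have himg : (range M).image (fun t => a * t % M) = range M := by
    apply eq_of_subset_of_card_le
    · intro x hx
      simp only [mem_image, mem_range] at hx ⊢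
      obtain ⟨t, -, rfl⟩ := hx
      exact Nat.mod_lt _ hM
    · rw [card_image_of_injOn hinj]
  rw [← sum_image hinj, himg]

/-- **Stub D (the 2-adic chirp).** For `k ≥ 3`, an odd multiplier `a = 2b+1` and
`φ(u) = s(a·ind u mod 2^{k−2})` with the square wave `s(x) = [x < 2^{k−3}] − [x ≥ 2^{k−3}]`:
(i) `φ` sums to `0` on every class `u ≡ w (mod 2^j)`, `w` odd, `1 ≤ j ≤ k−1` (adding `2^{k−3}`
preserves the progressions `t ≡ t₀ (mod 2^{j−2})` of `ℤ/2^{k−2}` and flips the sign of `s(a t)`);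
(ii) if `a·ind(p)/2^{k−2}` is within `δ` of `1/2 (mod 1)` then
`#{u < 2^k odd : φ(pu) = φ(u)} ≤ 2δ·2^{k−1} + 2` (a shift of the square wave by `θ` agrees with it on
`|2^{k−2} − 2θ|` points of a period). [folklore] -/
theorem stub_chirp (k : ℕ) (hk : 3 ≤ k) (ind : ℕ → ℕ)
    (hhom : ∀ u v, Odd u → Odd v → ind (u * v) = (ind u + ind v) % 2 ^ (k - 2))
    (hbij : ∀ j, 2 ≤ j → j ≤ k → ∀ w, Odd w → ∀ g : ℕ → ℝ,
      ∑ u ∈ (range (2 ^ k)).filter (fun u => u % 2 ^ j = w % 2 ^ j), g (ind u) =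
        ∑ t ∈ (range (2 ^ (k - 2))).filter (fun t => t % 2 ^ (j - 2) = ind w % 2 ^ (j - 2)), g t)
    (b : ℕ) (φ : ℕ → ℝ)
    (hφ : ∀ u, φ u = if (2 * b + 1) * ind u % 2 ^ (k - 2) < 2 ^ (k - 3) then 1 else -1) :
    (∀ j, 1 ≤ j → j + 1 ≤ k → ∀ w, Odd w →
      ∑ u ∈ (range (2 ^ k)).filter (fun u => u % 2 ^ j = w % 2 ^ j), φ u = 0) ∧
    (∀ p, Odd p → ∀ δ : ℝ, 0 ≤ δ →
      (∃ m : ℤ, |((2 * b + 1 : ℕ) : ℝ) * ind p / 2 ^ (k - 2) - 1 / 2 - m| ≤ δ) →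
      (((range (2 ^ k)).filter (fun u => Odd u ∧ φ (p * u) = φ u)).card : ℝ) ≤
        2 * δ * 2 ^ (k - 1) + 2) := by
  -- notation: `M = 2^(k-2)`, `H = 2^(k-3)`, `a = 2b+1`
  set M := 2 ^ (k - 2) with hM
  set H := 2 ^ (k - 3) with hH
  set a := 2 * b + 1 with ha
  have hMH : M = H + H := by
    rw [hM, hH, ← two_mul, ← pow_succ']; congr 1; omega
  have hHpos : 0 < H := by rw [hH]; positivity
  have hMpos : 0 < M := by omega
  have hcop : Nat.Coprime a M := by
    rw [hM]; exact Nat.Coprime.pow_right _ (Nat.coprime_two_right.mpr ⟨b, ha⟩)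
  -- adding `H` flips the square wave
  have hflip : ∀ x, x < M → ((H + x) % M < H ↔ ¬ x < H) := by
    intro x hx
    rcases Nat.lt_or_ge x H with h | h
    · rw [Nat.mod_eq_of_lt (by omega)]; omega
    · rw [Nat.mod_eq_sub_mod (by omega), Nat.mod_eq_of_lt (by omega)]; omega
  -- the square wave composed with multiplication by `a`
  set g : ℕ → ℝ := fun t => if a * t % M < H then 1 else -1 with hg
  have hgflip : ∀ t, g (H + t) = -g t := by
    intro t
    have h1 : a * (H + t) = (H + a * t) + M * b := by rw [ha, hMH]; ring
    have h2 : a * (H + t) % M = (H + a * t % M) % M := by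
      rw [h1, Nat.add_mul_mod_self_left, Nat.add_mod_mod]
    have h3 := hflip (a * t % M) (Nat.mod_lt _ hMpos)
    simp only [hg, h2]
    by_cases hc : a * t % M < H
    · have hn : ¬ (H + a * t % M) % M < H := fun h' => (h3.mp h') hc
      rw [if_pos hc, if_neg hn]
    · rw [if_neg hc, if_pos (h3.mpr hc)]; norm_num
  -- `g` is balanced on every progression `t ≡ c (mod 2^i)` of `range M`, `2^i ∣ H`
  have hbal0 : ∀ i c, i ≤ k - 3 → ∑ t ∈ (range M).filter (fun t => t % 2 ^ i = c), g t = 0 := by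
    intro i c hi
    obtain ⟨q, hq⟩ : 2 ^ i ∣ H := hH ▸ pow_dvd_pow 2 hi
    rw [Finset.sum_filter, hMH, Finset.sum_range_add, ← Finset.sum_add_distrib]
    refine Finset.sum_eq_zero fun t _ => ?_
    have hmod : (H + t) % 2 ^ i = t % 2 ^ i := by rw [hq, Nat.mul_add_mod_self_left]
    rw [hmod, hgflip]
    split_ifs <;> ring
  -- (i) for `2 ≤ j ≤ k - 1`
  have hbal2 : ∀ j, 2 ≤ j → j + 1 ≤ k → ∀ w, Odd w →
      ∑ u ∈ (range (2 ^ k)).filter (fun u => u % 2 ^ j = w % 2 ^ j), φ u = 0 := by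
    intro j hj hjk w hw
    have : ∑ u ∈ (range (2 ^ k)).filter (fun u => u % 2 ^ j = w % 2 ^ j), φ u =
        ∑ u ∈ (range (2 ^ k)).filter (fun u => u % 2 ^ j = w % 2 ^ j), g (ind u) :=
      Finset.sum_congr rfl fun u _ => by rw [hφ u]
    rw [this, hbij j hj (by omega) w hw g]
    exact hbal0 (j - 2) _ (by omega)
  -- (i) in general (`j = 1`: split the odd numbers into the classes of `1` and `3` modulo `4`)
  have hbal : ∀ j, 1 ≤ j → j + 1 ≤ k → ∀ w, Odd w →
      ∑ u ∈ (range (2 ^ k)).filter (fun u => u % 2 ^ j = w % 2 ^ j), φ u = 0 := by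
    intro j hj hjk w hw
    rcases Nat.lt_or_ge j 2 with hj2 | hj2
    · obtain rfl : j = 1 := by omega
      have hw2 : w % 2 = 1 := Nat.odd_iff.mp hw
      have hsplit : (range (2 ^ k)).filter (fun u => u % 2 ^ 1 = w % 2 ^ 1) =
          (range (2 ^ k)).filter (fun u => u % 2 ^ 2 = 1 % 2 ^ 2) ∪
          (range (2 ^ k)).filter (fun u => u % 2 ^ 2 = 3 % 2 ^ 2) := by
        ext u; simp only [mem_filter, mem_union, mem_range]; omega
      have hdisj : Disjoint ((range (2 ^ k)).filter (fun u => u % 2 ^ 2 = 1 % 2 ^ 2))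
          ((range (2 ^ k)).filter (fun u => u % 2 ^ 2 = 3 % 2 ^ 2)) := by
        rw [Finset.disjoint_filter]; intro u _ h1; omega
      rw [hsplit, Finset.sum_union hdisj, hbal2 2 le_rfl hk 1 odd_one, hbal2 2 le_rfl hk 3 (by decide),
        add_zero]
    · exact hbal2 j hj2 hjk w hw
  refine ⟨hbal, ?_⟩
  -- (ii)
  rintro p hp δ hδ ⟨m, hm⟩
  set θ := a * ind p % M with hθ
  have hθM : θ < M := Nat.mod_lt _ hMpos
  -- `φ(pu) = s(x_u + θ)`
  have hkey : ∀ t, a * ((ind p + t) % M) % M = (a * t % M + θ) % M := by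
    intro t
    calc a * ((ind p + t) % M) % M = a * (ind p + t) % M := by
          rw [Nat.mul_mod, Nat.mod_mod, ← Nat.mul_mod]
      _ = (a * t + a * ind p) % M := by rw [mul_add, add_comm]
      _ = (a * t % M + θ) % M := by rw [hθ]; exact Nat.add_mod _ _ _
  -- the agreement indicator, as a function of `x = a t mod M`
  set G : ℕ → ℝ := fun x => if ((x + θ) % M < H ↔ x < H) then 1 else 0 with hG
  -- the count as a sum over the odd `u < 2^k`
  have hS : ((((range (2 ^ k)).filter (fun u => Odd u ∧ φ (p * u) = φ u)).card : ℕ) : ℝ) =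
      ∑ u ∈ (range (2 ^ k)).filter (fun u => Odd u), G (a * ind u % M) := by
    rw [Finset.card_filter, Finset.sum_filter]
    push_cast
    refine Finset.sum_congr rfl fun u _ => ?_
    by_cases hu : Odd u
    · have hiff : φ (p * u) = φ u ↔ ((a * ind u % M + θ) % M < H ↔ a * ind u % M < H) := by
        rw [hφ (p * u), hφ u, hhom p u hp hu, hkey (ind u)]
        exact ite_pm_one_eq_iff _ _
      simp only [hu, true_and, if_true, hG, hiff]
    · simp [hu]
  -- the odd numbers below `2^k` are the classes of `1` and `3` modulo `4`
  have hodd : (range (2 ^ k)).filter (fun u => Odd u) =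
      (range (2 ^ k)).filter (fun u => u % 2 ^ 2 = 1 % 2 ^ 2) ∪
      (range (2 ^ k)).filter (fun u => u % 2 ^ 2 = 3 % 2 ^ 2) := by
    ext u; simp only [mem_filter, mem_union, mem_range, Nat.odd_iff]; omega
  have hdisj : Disjoint ((range (2 ^ k)).filter (fun u => u % 2 ^ 2 = 1 % 2 ^ 2))
      ((range (2 ^ k)).filter (fun u => u % 2 ^ 2 = 3 % 2 ^ 2)) := by
    rw [Finset.disjoint_filter]; intro u _ h1; omega
  -- on each class modulo `4`, `ind` is a bijection onto `range M`, and `t ↦ a t mod M` permutes `range M`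
  have hclass : ∀ w, Odd w →
      ∑ u ∈ (range (2 ^ k)).filter (fun u => u % 2 ^ 2 = w % 2 ^ 2), G (a * ind u % M) =
        ∑ x ∈ range M, G x := by
    intro w hw
    have h1 := hbij 2 le_rfl (by omega) w hw (fun t => G (a * t % M))
    have hf : (range M).filter (fun t => t % 2 ^ (2 - 2) = ind w % 2 ^ (2 - 2)) = range M :=
      Finset.filter_true_of_mem fun t _ => by rw [Nat.sub_self, pow_zero, Nat.mod_one, Nat.mod_one]
    rw [h1, hf]
    exact sum_range_mul_mod M a hMpos hcop G
  have hGsum : ∑ x ∈ range M, G x =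
      ((((range M).filter (fun x => ((x + θ) % M < H ↔ x < H))).card : ℕ) : ℝ) := by
    simp only [hG]
    exact Finset.sum_boole _ _
  set cA := ((range M).filter (fun x => ((x + θ) % M < H ↔ x < H))).card with hcA
  have hcard : ((((range (2 ^ k)).filter (fun u => Odd u ∧ φ (p * u) = φ u)).card : ℕ) : ℝ) = 2 * cA := by
    rw [hS, hodd, Finset.sum_union hdisj, hclass 1 odd_one, hclass 3 (by decide), hGsum]; ring
  have hcAM : cA ≤ M := (card_filter_le _ _).trans (card_range M).le
  have hcAθ : (cA : ℝ) ≤ |(M : ℝ) - 2 * θ| := card_shift_agree_le M H θ hMH hθM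
  -- numerics
  have hMR : (0 : ℝ) < M := by exact_mod_cast hMpos
  have h2k2 : (2 : ℝ) ^ (k - 2) = M := by rw [hM]; push_cast; rfl
  have h2k1 : (2 : ℝ) ^ (k - 1) = 2 * M := by
    rw [hM]; push_cast; rw [← pow_succ']; congr 1; omega
  have hcAMR : (cA : ℝ) ≤ M := by exact_mod_cast hcAM
  -- `a * ind p = M * q + θ`
  set q := a * ind p / M with hq
  have hdecomp : (a : ℝ) * (ind p : ℝ) = (M : ℝ) * q + θ := by
    have h := Nat.div_add_mod (a * ind p) M
    exact_mod_cast h.symm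
  rw [h2k2, hdecomp] at hm
  have hm' : |(θ : ℝ) / M - 1 / 2 - ((m - q : ℤ) : ℝ)| ≤ δ := by
    have : (θ : ℝ) / M - 1 / 2 - ((m - q : ℤ) : ℝ) = ((M : ℝ) * q + θ) / M - 1 / 2 - m := by
      push_cast; field_simp; ring
    rw [this]; exact hm
  rcases eq_or_ne (m - q : ℤ) 0 with hn | hn
  · -- the main case: `|M - 2θ| ≤ 2δM`
    rw [hn, Int.cast_zero, sub_zero, abs_le] at hm'
    have e1 : ((θ : ℝ) / M - 1 / 2) * (2 * M) = 2 * θ - M := by field_simp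
    have lo := mul_le_mul_of_nonneg_right hm'.1 (by positivity : (0 : ℝ) ≤ 2 * M)
    have hi := mul_le_mul_of_nonneg_right hm'.2 (by positivity : (0 : ℝ) ≤ 2 * M)
    rw [e1] at lo hi
    have habs : |(M : ℝ) - 2 * θ| ≤ 2 * δ * M := abs_le.mpr ⟨by linarith, by linarith⟩
    calc _ = 2 * (cA : ℝ) := hcard
      _ ≤ 2 * (2 * δ * M) := by linarith
      _ = 2 * δ * 2 ^ (k - 1) := by rw [h2k1]; ring
      _ ≤ 2 * δ * 2 ^ (k - 1) + 2 := by linarith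
  · -- otherwise `δ ≥ 1/2` and the trivial bound `2M = 2^(k-1)` suffices
    have hn1 : (1 : ℝ) ≤ |((m - q : ℤ) : ℝ)| := by
      rw [← Int.cast_abs]; exact_mod_cast Int.one_le_abs hn
    have hθR : (0 : ℝ) ≤ θ / M ∧ (θ : ℝ) / M < 1 := by
      constructor
      · positivity
      · rw [div_lt_one hMR]; exact_mod_cast hθM
    have h1 : |(θ : ℝ) / M - 1 / 2| ≤ 1 / 2 := abs_le.mpr ⟨by linarith [hθR.1], by linarith [hθR.2]⟩
    have hδ12 : (1 : ℝ) / 2 ≤ δ := by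
      have h2 := abs_sub_abs_le_abs_sub (((m - q : ℤ) : ℝ)) ((θ : ℝ) / M - 1 / 2)
      have h4 : |((m - q : ℤ) : ℝ) - ((θ : ℝ) / M - 1 / 2)| =
          |(θ : ℝ) / M - 1 / 2 - ((m - q : ℤ) : ℝ)| := abs_sub_comm _ _
      linarith
    calc _ = 2 * (cA : ℝ) := hcard
      _ ≤ 1 * (2 * M) := by linarith
      _ ≤ 2 * δ * (2 * M) := mul_le_mul_of_nonneg_right (by linarith) (by positivity)
      _ = 2 * δ * 2 ^ (k - 1) := by rw [h2k1]
      _ ≤ 2 * δ * 2 ^ (k - 1) + 2 := by linarith
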